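import Summits.KontsevichZagierPeriods.KontsevichZagierPeriods.Theorems.UnfoldedStokesStokesGenerationStubRungExactElement
import Summits.KontsevichZagierPeriods.KontsevichZagierPeriods.Theorems.UnfoldedStokesStokesGenerationFibrewiseRungTransport
import Summits.KontsevichZagierPeriods.KontsevichZagierPeriods.Theorems.UnfoldedStokesStokesGenerationFibrewiseClosureSum
import Summits.KontsevichZagierPeriods.KontsevichZagierPeriods.Theorems.UnfoldedStokesStokesGenerationFibrewiseClosureCongr

/-!
# `StokesGeneration` (stmt-KontsevichZagierPeriods-3586) — line `fibrewise_stokes`, stub `stub_exactSwap`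

Registered rung stub V8 (rung 9) of the line `fibrewise_stokes` of the crux `StokesGeneration` (route
UnfoldedStokes): **the exact transposition** `g₀ (x 0) − g₀ (x 1)` of a one-variable EXACT atom `g₀ = G₀′`
between the two coordinates of the square `[0,1]²` is fibrewise-Stokes decomposable
(`FibStokesDecomposable 2`, `Theorems/UnfoldedStokesDefs.lean`).

Proof (pure bookkeeping over landed files). By `stub_rungExactElement` (with the `Fin 2` readings of the
`Fin 1` semialgebraicity hypotheses, `isSemialgebraicFunOn_sq_of_interval`) there is ONE fibrewise Stokes
element in direction `0` carried by the closed square with integrand `q.integrand x = g₀ (x 0) − r`,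
`r := G₀ 1 − G₀ 0`; it is decomposable (`fibStokesDecomposable_element`, empty kink set). Transporting
along the coordinate swap (`fibStokesDecomposable_perm`, `σ = Equiv.swap 0 1`) gives decomposability of
`x ↦ q.integrand (x ∘ σ) = g₀ (x 1) − r` on the square; the difference (`fibStokesDecomposable_sub`) agrees
with `g₀ (x 0) − g₀ (x 1)` at every point of the square, so `fibStokesDecomposable_congr_off_null` with the
empty null set concludes.

References: M. Kontsevich, D. Zagier, *Periods* (2001), §1.2 (rule (3), Newton–Leibniz/Stokes);
J. Ayoub, Ann. of Math. 181 (2015), Rem. 1.5.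
-/

noncomputable section

-- `Summit.KontsevichZagierPeriods.KontsevichZagierPeriods.…` is the tree's mandated layout (single-conjunct summit).
set_option linter.dupNamespace false

namespace Summit.KontsevichZagierPeriods.KontsevichZagierPeriods.Cruxes.StokesGeneration.FibrewiseStokes

open MeasureTheory Set
open Literature.NumberTheory.Transcendental
open Literature.NumberTheory.Transcendental.KZ
open Literature.ModelTheory.ExponentialFields (IsSemialgebraic)

/-- **Registered stub `stub_exactSwap` (rung 9, V8): the exact transposition.** For `G₀` continuous on
`[0,1]` and differentiable inside with continuous derivative `g₀`, both `ℚ`-semialgebraic, the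
transposition `g₀(x₀) − g₀(x₁)` is fibrewise-Stokes decomposable on the square: two elements,
`∂₀[G₀(x₀)] − (G₀(1) − G₀(0))` and `−(∂₁[G₀(x₁)] − (G₀(1) − G₀(0)))`. [folklore] -/
theorem stub_exactSwap :
    ∀ (G₀ g₀ : ℝ → ℝ),
      IsSemialgebraicFunOn ℚ (Set.pi Set.univ (fun _ : Fin 1 => Set.Icc (0:ℝ) 1)) (fun z => G₀ (z 0)) →
      IsSemialgebraicFunOn ℚ (Set.pi Set.univ (fun _ : Fin 1 => Set.Icc (0:ℝ) 1)) (fun z => g₀ (z 0)) →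
      ContinuousOn G₀ (Set.Icc (0:ℝ) 1) → ContinuousOn g₀ (Set.Icc (0:ℝ) 1) →
      (∀ u ∈ Set.Ioo (0:ℝ) 1, HasDerivAt G₀ (g₀ u) u) →
      FibStokesDecomposable 2 (fun z => g₀ (z 0) - g₀ (z 1)) := by
  intro G₀ g₀ hG₀ hg₀ hG₀c hg₀c hder
  -- one fibrewise Stokes element in direction `0` on the square, integrand `g₀ (x 0) − (G₀ 1 − G₀ 0)`
  obtain ⟨G, D, q, ⟨hG, hD, hB, hcont, hdv⟩, ⟨hqd, hqi⟩, hq⟩ :=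
    stub_rungExactElement G₀ g₀ (isSemialgebraicFunOn_sq_of_interval hG₀)
      (isSemialgebraicFunOn_sq_of_interval hg₀) hG₀c hg₀c hder
  -- it is decomposable (empty kink set)
  have h₁ : FibStokesDecomposable 2 q.integrand :=
    fibStokesDecomposable_element 2 0 G D ∅ q hG hD
      Literature.ModelTheory.ExponentialFields.isSemialgebraic_empty hB
      (fun x _ => by simp only [Set.mem_empty_iff_false, Set.setOf_false, Set.finite_empty]) hcont
      (fun x hx _ hx0 => hdv x hx hx0) hqd hqi
  -- its transport along the coordinate swap is decomposable
  have h₂ : FibStokesDecomposable 2 (fun x => q.integrand (fun l => x (Equiv.swap (0 : Fin 2) 1 l))) :=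
    fibStokesDecomposable_perm 2 (Equiv.swap (0 : Fin 2) 1) q.integrand h₁
  -- the difference agrees with `g₀ (x 0) − g₀ (x 1)` on the square
  refine fibStokesDecomposable_congr_off_null 2 _ _ ∅
    Literature.ModelTheory.ExponentialFields.isSemialgebraic_empty measure_empty ?_
    (fibStokesDecomposable_sub 2 _ _ h₁ h₂)
  intro x hx _
  have hx' : (fun l => x (Equiv.swap (0 : Fin 2) 1 l)) ∈
      Set.pi Set.univ (fun _ : Fin 2 => Set.Icc (0:ℝ) 1) :=
    fun l _ => hx _ (Set.mem_univ _)
  show q.integrand x - q.integrand (fun l => x (Equiv.swap (0 : Fin 2) 1 l)) = g₀ (x 0) - g₀ (x 1)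
  rw [hq x hx, hq _ hx', Equiv.swap_apply_left]
  ring

end Summit.KontsevichZagierPeriods.KontsevichZagierPeriods.Cruxes.StokesGeneration.FibrewiseStokes

end
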